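import Summits.CriticalPhenomena.SAWScalingLimit.Theorems.SAWTwistedSelfEnergySubseqIdentificationParaExplorationPrefix
import Mathlib.Probability.Martingale.Basic
import Mathlib.Order.PartialSups
import HarnessLib

/-!
# Per-scale exploration data for the frozen Doob parafermionic observable
(crux `SubseqIdentification`, stmt-CriticalPhenomena-0783; line `parafermionic-martingale`, split piece
S3b `stub_paraExplorationData` of the XL passage stub `stub_paraPassage`; stub-worker of the lead c6)

One mesh, the finite space of SAWs of `Ω_δ` from `a` to `b`, a target `z`, drivers `V γ` prefix-
consistent beyond capacity `S₀ ≤ s₁ ≤ t₁`, a horizon `T ≥ t₁ + 2θ`, stem capacity `≤ θ`, and the LOCAL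
cylinder identity of `Q_n = paraDoob` (statement S1 of the line at `(δ, z)`). Output, in the hypothesis
shape of the diagonal passage (cf. `exists_explorationDataPos` of the room line): the exploration
filtration (`SAW.exists_explorationFiltration`, running-maximum capacity clock), first passages
`σ ≤ τ ≤ M` of `s₁`, `t₁`, an EXACT complex martingale `G` — the observable FROZEN at the first bad past
(`z` on it, a dead step, capacity `> t₁ + θ`, or an available one-step continuation of capacity
increment `> θ`: a stopping rule, so `G` is a martingale by the cylinder identity on good cylinders, via
the Doob identity of the package read on `Re`/`Im` and `martingale_nat`), all of whose values are values
`Q_k` at pasts of capacity `≤ T`; `𝒢_σ`-measurability of `V γ u`, `u ≤ s₁`; and, off the strong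
capacity event, first-passage indices `j ≤ k` with capacities in `[s₁, s₁ + θ]`, `[t₁, t₁ + θ]` and the
DICHOTOMY `(G_σ = Q_j ∧ G_τ = Q_k) ∨ Q_k = 0` (`paraDoob_eq_zero_of_bad`).
References: H. Duminil-Copin, S. Smirnov, Clay Math. Proc. 15 (2012), Lemma 6.6, proof of Prop. 6.7;
D. Chelkak, H. Duminil-Copin, C. Hongler, A. Kemppainen, S. Smirnov, C. R. Math. 352 (2014), §3.
-/

noncomputable section

open MeasureTheory Filter Topology Set
open scoped NNReal ENNReal Classical BigOperators
open Literature.Probability.LatticeModels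
open Literature.Probability.RandomPlanarGeometry
open UpperHalfPlane (upperHalfPlaneSet)

namespace Summit.CriticalPhenomena.SAWScalingLimit.Theorems.SubseqIdentification.ParaMartingale

open Summit.CriticalPhenomena.SAWScalingLimit.Theorems.SubseqIdentification.RoomEntropy
  (prefixAt capTimeOf)

/-! ## The capacity clock along the walk's own steps -/

/-- **The walk's own next step is an available continuation**: its capacity increment is the
difference of consecutive past capacities. [folklore] -/
theorem capIncrement_prefixAt_getVert_succ {D : DobrushinDomain}
    (φ : ConformalEquiv upperHalfPlaneSet D.carrier) {δ : ℝ} {a b : Site 2}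
    (γ : SAW.DomainSAW D.carrier δ a b) {k : ℕ} (hk : k < γ.walk.length) :
    LatticeSlit.capIncrement φ (prefixAt γ k) (γ.walk.getVert (k + 1)) =
      LatticeSlit.capTime φ (prefixAt γ (k + 1)) - LatticeSlit.capTime φ (prefixAt γ k) := by
  have hadj : (discreteDomainGraph D.carrier δ).Adj (γ.walk.getVert k) (γ.walk.getVert (k + 1)) :=
    γ.walk.adj_getVert_succ hk
  rw [LatticeSlit.capIncrement, dif_pos hadj]
  congr 1
  refine SAW.apply_eq_of_support_eq
    (fun v (η : (discreteDomainGraph D.carrier δ).Walk a v) ↦ LatticeSlit.capTime φ η) ?_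
  rw [SimpleGraph.Walk.support_concat, support_prefixAt, support_prefixAt,
    γ.walk.getVert_eq_support_getElem (by omega : k + 1 ≤ γ.walk.length)]
  have hlt : k + 1 < γ.walk.support.length := by rw [γ.walk.length_support]; omega
  rw [List.take_succ_eq_append_getElem hlt]

/-! ## The per-scale exploration data -/

/-- **S3b `stub_paraExplorationData` (split of `stub_paraPassage`): per-scale exploration data for the
frozen Doob parafermionic observable** — see the module docstring. [cite: CDHKSCRAS2014, §3] -/
theorem stub_paraExplorationData :
    ∀ (D : DobrushinDomain) (δ : ℝ) (a a' b z : Site 2)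
      (φ : ConformalEquiv upperHalfPlaneSet D.carrier)
      [Finite (SAW.DomainSAW D.carrier δ a b)] [IsProbabilityMeasure (SAW.law D.carrier δ a b)]
      (V : SAW.DomainSAW D.carrier δ a b → C(ℝ≥0, ℝ)) (T θ : ℝ) (S₀ s₁ t₁ : ℝ≥0),
      0 ≤ θ → 0 < S₀ → S₀ ≤ s₁ → s₁ ≤ t₁ → (t₁ : ℝ) + 2 * θ ≤ T →
      (∀ (n : ℕ) (l : List (Site 2)), z ∉ l → l.length = n + 1 →
        (∀ v u : Site 2, l.getLast? = some v → (discreteDomainGraph D.carrier δ).Adj v u → u ∉ l →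
          (∃ ω : SAW.DomainSAW D.carrier δ u z, ∀ y ∈ ω.walk.support, y ∉ l) →
          ∃ ω : SAW.DomainSAW D.carrier δ u b, ∀ y ∈ ω.walk.support, y ∉ l) →
        ∫ γ in {γ : SAW.DomainSAW D.carrier δ a b | γ.walk.support.take (n + 1) = l},
            paraDoob D δ a a' b z γ (n + 1) ∂(SAW.law D.carrier δ a b) =
          ∫ γ in {γ : SAW.DomainSAW D.carrier δ a b | γ.walk.support.take (n + 1) = l},
            paraDoob D δ a a' b z γ n ∂(SAW.law D.carrier δ a b)) →
      (∀ γ : SAW.DomainSAW D.carrier δ a b, LatticeSlit.capTime φ (prefixAt γ 0) ≤ θ) →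
      (∀ (γ γ' : SAW.DomainSAW D.carrier δ a b) (k : ℕ),
        (prefixAt γ k).support = (prefixAt γ' k).support →
        (S₀ : ℝ) ≤ LatticeSlit.capTime φ (prefixAt γ k) →
        ∀ u : ℝ≥0, (u : ℝ) ≤ LatticeSlit.capTime φ (prefixAt γ k) → V γ u = V γ' u) →
      ∃ (𝒢 : Filtration ℕ (inferInstance : MeasurableSpace (SAW.DomainSAW D.carrier δ a b)))
        (σ τ : SAW.DomainSAW D.carrier δ a b → WithTop ℕ) (hσ : IsStoppingTime 𝒢 σ) (M : ℕ)
        (G : ℕ → SAW.DomainSAW D.carrier δ a b → ℂ),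
        IsStoppingTime 𝒢 τ ∧ Martingale G 𝒢 (SAW.law D.carrier δ a b) ∧ σ ≤ τ ∧ (∀ γ, τ γ ≤ M) ∧
        (∀ u, u ≤ s₁ → Measurable[hσ.measurableSpace] fun γ => V γ u) ∧
        (∀ (n : ℕ) (γ : SAW.DomainSAW D.carrier δ a b), ∃ k : ℕ,
          G n γ = paraDoob D δ a a' b z γ k ∧ LatticeSlit.capTime φ (prefixAt γ k) ≤ T) ∧
        ∀ γ : SAW.DomainSAW D.carrier δ a b,
          γ ∉ {γ : SAW.DomainSAW D.carrier δ a b |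
                (∀ k : ℕ, LatticeSlit.capTime φ (prefixAt γ k) ≤ T) ∨
                ∃ (k : ℕ) (u : Site 2), LatticeSlit.capTime φ (prefixAt γ k) ≤ T ∧
                  θ < LatticeSlit.capIncrement φ (prefixAt γ k) u} →
          ∃ j k : ℕ, σ γ = j ∧ τ γ = k ∧
            (s₁ : ℝ) ≤ LatticeSlit.capTime φ (prefixAt γ j) ∧
            LatticeSlit.capTime φ (prefixAt γ j) ≤ s₁ + θ ∧
            (t₁ : ℝ) ≤ LatticeSlit.capTime φ (prefixAt γ k) ∧
            LatticeSlit.capTime φ (prefixAt γ k) ≤ t₁ + θ ∧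
            (stoppedValue G σ γ = paraDoob D δ a a' b z γ j ∧
                stoppedValue G τ γ = paraDoob D δ a a' b z γ k ∨
              paraDoob D δ a a' b z γ k = 0) := by
  intro D δ a a' b z φ _ _ V T θ S₀ s₁ t₁ hθ _ hS hst hT hcyl hstem hcons
  set P := SAW.law D.carrier δ a b with hP
  set f : SAW.DomainSAW D.carrier δ a b → ℕ → ℝ := fun γ n ↦ LatticeSlit.capTime φ (prefixAt γ n)
    with hf
  have hnest : ∀ {i n : ℕ}, i ≤ n → ∀ {γ γ' : SAW.DomainSAW D.carrier δ a b},
      (prefixAt γ n).support = (prefixAt γ' n).support →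
      (prefixAt γ i).support = (prefixAt γ' i).support :=
    fun hin γ γ' h ↦ SAW.support_takeUntil_getVert_eq_of_le γ.isPath γ'.isPath hin h
  have hfdet : ∀ {n : ℕ} {γ γ' : SAW.DomainSAW D.carrier δ a b},
      (prefixAt γ n).support = (prefixAt γ' n).support → f γ n = f γ' n := fun h ↦
    SAW.apply_eq_of_support_eq
      (fun v (η : (discreteDomainGraph D.carrier δ).Walk a v) ↦ LatticeSlit.capTime φ η) h
  have hflen : ∀ (γ : SAW.DomainSAW D.carrier δ a b) {n : ℕ}, γ.walk.length ≤ n →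
      f γ n = f γ γ.walk.length := fun γ n hn ↦
    SAW.apply_eq_of_support_eq
      (fun v (η : (discreteDomainGraph D.carrier δ).Walk a v) ↦ LatticeSlit.capTime φ η)
      ((SAW.support_takeUntil_getVert_of_length_le γ.isPath hn).trans
        (SAW.support_takeUntil_getVert_of_length_le γ.isPath le_rfl).symm)
  -- one-step increments of the clock are increments of available continuations (or zero)
  have hstep : ∀ (γ : SAW.DomainSAW D.carrier δ a b) (k : ℕ) (c : ℝ), 0 ≤ c →
      (∀ u : Site 2, LatticeSlit.capIncrement φ (prefixAt γ k) u ≤ c) → f γ (k + 1) ≤ f γ k + c := by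
    intro γ k c hc h
    rcases lt_or_ge k γ.walk.length with hk | hk
    · have := h (γ.walk.getVert (k + 1))
      rw [capIncrement_prefixAt_getVert_succ φ γ hk] at this
      simp only [hf]; linarith
    · rw [hflen γ (Nat.le_succ_of_le hk), ← hflen γ hk]
      linarith
  have hcdet : ∀ (γ γ' : SAW.DomainSAW D.carrier δ a b) (n : ℕ),
      (prefixAt γ n).support = (prefixAt γ' n).support →
      partialSups (f γ) n = partialSups (f γ') n := by
    intro γ γ' n h
    have key : ∀ i ≤ n, f γ i = f γ' i := fun i hi ↦ hfdet (hnest hi h)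
    refine le_antisymm (partialSups_le _ _ _ fun i hi ↦ ?_) (partialSups_le _ _ _ fun i hi ↦ ?_)
    · rw [key i hi]; exact le_partialSups_of_le _ hi
    · rw [← key i hi]; exact le_partialSups_of_le _ hi
  obtain ⟨𝒢, M, σ, τ, hσ, hτ, hστ, hτM, hMlen, h𝒢, hDoob, hσspec, hτspec, hσlt, -, hσmeas, hfull⟩ :=
    SAW.exists_explorationFiltration
      (fun (γ : SAW.DomainSAW D.carrier δ a b) n ↦ partialSups (f γ) n) hcdet
      (show (s₁ : ℝ) ≤ t₁ from NNReal.coe_le_coe.2 hst)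
  -- every clock value is below the terminal running maximum
  have hfM : ∀ (γ : SAW.DomainSAW D.carrier δ a b) (k : ℕ), f γ k ≤ partialSups (f γ) M := by
    intro γ k
    rcases le_total k M with hk | hk
    · exact le_partialSups_of_le (f γ) hk
    · rw [hflen γ ((hMlen γ).trans hk), ← hflen γ (hMlen γ)]; exact le_partialSups (f γ) M
  /- the good pasts and the freezing index -/
  set Fgood : ∀ v : Site 2, (discreteDomainGraph D.carrier δ).Walk a v → Prop := fun v η ↦
    z ∉ η.support ∧
    (∀ x u : Site 2, η.support.getLast? = some x → (discreteDomainGraph D.carrier δ).Adj x u →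
      u ∉ η.support → (∃ ω : SAW.DomainSAW D.carrier δ u z, ∀ y ∈ ω.walk.support, y ∉ η.support) →
      ∃ ω : SAW.DomainSAW D.carrier δ u b, ∀ y ∈ ω.walk.support, y ∉ η.support) ∧
    LatticeSlit.capTime φ η ≤ t₁ + θ ∧ ∀ u : Site 2, LatticeSlit.capIncrement φ η u ≤ θ with hFgood
  set Good : ℕ → SAW.DomainSAW D.carrier δ a b → Prop := fun n γ ↦ Fgood _ (prefixAt γ n) with hGood
  have hGooddet : ∀ {n : ℕ} {γ γ' : SAW.DomainSAW D.carrier δ a b},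
      (prefixAt γ n).support = (prefixAt γ' n).support → (Good n γ ↔ Good n γ') := fun h ↦ by
    simp only [hGood]; rw [SAW.apply_eq_of_support_eq Fgood h]
  have hex : ∀ γ : SAW.DomainSAW D.carrier δ a b, ∃ n, ¬ Good n γ ∨ M ≤ n :=
    fun γ ↦ ⟨M, Or.inr le_rfl⟩
  set fb : SAW.DomainSAW D.carrier δ a b → ℕ := fun γ ↦ Nat.find (hex γ) with hfb
  have hgood_of_lt : ∀ {γ : SAW.DomainSAW D.carrier δ a b} {i : ℕ}, i < fb γ → Good i γ := by
    intro γ i hi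
    exact not_not.1 (not_or.1 (Nat.find_min (hex γ) hi)).1
  -- the freezing index up to `n` is determined by the past `γ[0,n]`
  have hfbkey : ∀ {n : ℕ} {γ γ' : SAW.DomainSAW D.carrier δ a b},
      (prefixAt γ n).support = (prefixAt γ' n).support → fb γ ≤ n → fb γ' = fb γ := by
    intro n γ γ' h hle
    have hP : ∀ i ≤ n, ((¬ Good i γ ∨ M ≤ i) ↔ (¬ Good i γ' ∨ M ≤ i)) := fun i hi ↦ by
      rw [hGooddet (hnest hi h)]
    rw [hfb, Nat.find_eq_iff]
    refine ⟨(hP _ hle).1 (Nat.find_spec (hex γ)), fun i hi hi' ↦ ?_⟩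
    exact Nat.find_min (hex γ) hi ((hP i (hi.le.trans hle)).2 hi')
  have hfbmin : ∀ {n : ℕ} {γ γ' : SAW.DomainSAW D.carrier δ a b},
      (prefixAt γ n).support = (prefixAt γ' n).support → min n (fb γ) = min n (fb γ') := by
    intro n γ γ' h
    rcases le_or_gt (fb γ) n with h1 | h1
    · rw [hfbkey h h1]
    · rcases le_or_gt (fb γ') n with h2 | h2
      · rw [hfbkey h.symm h2]
      · rw [min_eq_left h1.le, min_eq_left h2.le]
  set Q : SAW.DomainSAW D.carrier δ a b → ℕ → ℂ := fun γ k ↦ paraDoob D δ a a' b z γ k with hQ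
  have hQdet : ∀ {k n : ℕ} {γ γ' : SAW.DomainSAW D.carrier δ a b}, k ≤ n →
      (prefixAt γ n).support = (prefixAt γ' n).support → Q γ k = Q γ' k := by
    intro k n γ γ' hkn h
    simp only [hQ, paraDoob]
    rw [SAW.apply_eq_of_support_eq (fun v η ↦ pastObs D.carrier δ a' b η z) (hnest hkn h),
      SAW.apply_eq_of_support_eq (fun v η ↦ pastObs D.carrier δ a' b η z) (hnest (Nat.zero_le n) h)]
  have hQlen : ∀ (γ : SAW.DomainSAW D.carrier δ a b) {n : ℕ}, γ.walk.length ≤ n →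
      Q γ n = Q γ γ.walk.length := by
    intro γ n hn
    have e : pastObs D.carrier δ a' b (prefixAt γ n) z =
        pastObs D.carrier δ a' b (prefixAt γ γ.walk.length) z :=
      SAW.apply_eq_of_support_eq (fun v η ↦ pastObs D.carrier δ a' b η z)
        ((SAW.support_takeUntil_getVert_of_length_le γ.isPath hn).trans
          (SAW.support_takeUntil_getVert_of_length_le γ.isPath le_rfl).symm)
    simp only [hQ, paraDoob, e]
  set G : ℕ → SAW.DomainSAW D.carrier δ a b → ℂ := fun n γ ↦ Q γ (min n (fb γ)) with hG
  have hGdet : ∀ (n : ℕ) (γ γ' : SAW.DomainSAW D.carrier δ a b),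
      (prefixAt γ n).support = (prefixAt γ' n).support → G n γ = G n γ' := by
    intro n γ γ' h
    simp only [hG]
    rw [hfbmin h]
    exact hQdet (min_le_left _ _) h
  have hGad : StronglyAdapted 𝒢 G := by
    intro n
    have hre : Measurable[𝒢 n] fun γ ↦ (G n γ).re := h𝒢 n _ fun γ γ' h ↦ by rw [hGdet n γ γ' h]
    have him : Measurable[𝒢 n] fun γ ↦ (G n γ).im := h𝒢 n _ fun γ γ' h ↦ by rw [hGdet n γ γ' h]
    have heq : G n = fun γ ↦ ((G n γ).re : ℂ) + ((G n γ).im : ℂ) * Complex.I := by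
      funext γ; exact (Complex.re_add_im _).symm
    rw [heq]
    exact ((Complex.measurable_ofReal.comp hre).add
      ((Complex.measurable_ofReal.comp him).mul_const _)).stronglyMeasurable
  have hint : ∀ n, Integrable (G n) P := fun n ↦ Integrable.of_finite
  set cyl : SAW.DomainSAW D.carrier δ a b → ℕ → Set (SAW.DomainSAW D.carrier δ a b) := fun γ n ↦
    {γ' | γ'.walk.support.take (n + 1) = γ.walk.support.take (n + 1)} with hcyl_def
  have hmem_cyl : ∀ {γ γ' : SAW.DomainSAW D.carrier δ a b} {n : ℕ}, γ' ∈ cyl γ n →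
      (prefixAt γ' n).support = (prefixAt γ n).support := fun h ↦ by
    rw [support_prefixAt, support_prefixAt]; exact h
  have hGcyl : ∀ (γ₀ : SAW.DomainSAW D.carrier δ a b) (n : ℕ),
      ∫ x in cyl γ₀ n, G (n + 1) x ∂P = ∫ x in cyl γ₀ n, G n x ∂P := by
    intro γ₀ n
    rcases le_or_gt (fb γ₀) n with hle | hgt
    · refine setIntegral_congr_fun MeasurableSpace.measurableSet_top fun γ hγ ↦ ?_
      have hfbγ : fb γ = fb γ₀ := hfbkey (hmem_cyl hγ).symm hle
      show Q γ (min (n + 1) (fb γ)) = Q γ (min n (fb γ))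
      rw [hfbγ, min_eq_right (hle.trans n.le_succ), min_eq_right hle]
    · have hgood : Good n γ₀ := hgood_of_lt hgt
      have hfbγ : ∀ γ ∈ cyl γ₀ n, n < fb γ := fun γ hγ ↦ by
        by_contra hge
        have := hfbkey (hmem_cyl hγ) (not_lt.1 hge)
        omega
      have hG1 : ∀ γ ∈ cyl γ₀ n, G (n + 1) γ = Q γ (n + 1) := fun γ hγ ↦ by
        show Q γ (min (n + 1) (fb γ)) = _
        rw [min_eq_left (Nat.succ_le_of_lt (hfbγ γ hγ))]
      have hG0 : ∀ γ ∈ cyl γ₀ n, G n γ = Q γ n := fun γ hγ ↦ by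
        show Q γ (min n (fb γ)) = _
        rw [min_eq_left (hfbγ γ hγ).le]
      rw [setIntegral_congr_fun MeasurableSpace.measurableSet_top hG1,
        setIntegral_congr_fun MeasurableSpace.measurableSet_top hG0]
      rcases le_or_gt n γ₀.walk.length with hn | hn
      · -- `n ≤ |γ₀|`: the cylinder of a genuine past of length `n + 1` (S1)
        have hl : (γ₀.walk.support.take (n + 1)).length = n + 1 := by
          rw [List.length_take, γ₀.walk.length_support]; omega
        have hsupp : (prefixAt γ₀ n).support = γ₀.walk.support.take (n + 1) :=
          support_prefixAt γ₀ n
        obtain ⟨hz, hdead, -, -⟩ := hgood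
        rw [hsupp] at hz hdead
        exact hcyl n _ hz hl hdead
      · -- `|γ₀| < n`: both pasts are the whole walk
        refine setIntegral_congr_fun MeasurableSpace.measurableSet_top fun γ hγ ↦ ?_
        have h1 := congrArg List.length (show γ.walk.support.take (n + 1) = _ from hγ)
        rw [List.length_take, List.length_take, γ.walk.length_support,
          γ₀.walk.length_support] at h1
        have hlen : γ.walk.length < n := by omega
        show Q γ (n + 1) = Q γ n
        rw [hQlen γ (Nat.le_succ_of_le hlen.le), hQlen γ hlen.le]
  /- `G` is a martingale: the Doob identity of the package, read on `Re` and `Im` -/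
  have hnull : ∀ n, ∀ᵐ γ ∂P, P (cyl γ n) ≠ 0 := fun n ↦ by
    have h0 : P {γ | P (cyl γ n) = 0} = 0 := by
      rw [← Set.biUnion_of_singleton {γ | P (cyl γ n) = 0},
        measure_biUnion_null_iff (Set.to_countable _)]
      exact fun γ hγ ↦ measure_mono_null (Set.singleton_subset_iff.2 (show γ ∈ cyl γ n from rfl)) hγ
    rw [ae_iff]; simpa only [not_not] using h0
  have hcylD : ∀ (γ : SAW.DomainSAW D.carrier δ a b) (n : ℕ),
      {γ' : SAW.DomainSAW D.carrier δ a b | ∃ hw : γ.walk.getVert n ∈ γ'.walk.support,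
          γ'.walk.takeUntil (γ.walk.getVert n) hw =
            γ.walk.takeUntil (γ.walk.getVert n) (γ.walk.getVert_mem_support n)} = cyl γ n := by
    intro γ n
    rw [SAW.DomainSAW.setOf_exists_takeUntil_eq γ n]
    ext γ'
    simp only [mem_preimage, mem_singleton_iff, SAW.support_takeUntil_getVert γ'.isPath,
      SAW.support_takeUntil_getVert γ.isPath]; rfl
  have hreal : ∀ (L : ℂ →L[ℝ] ℝ) (n : ℕ),
      P[fun γ ↦ L (G (n + 1) γ) | 𝒢 n] =ᵐ[P] fun γ ↦ L (G n γ) := by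
    intro L n
    filter_upwards [hDoob P (fun γ ↦ L (G (n + 1) γ)) n, hnull n] with γ hγ hγ0
    rw [hγ, hcylD]
    have h1 : ∫ x in cyl γ n, L (G (n + 1) x) ∂P = L (∫ x in cyl γ n, G (n + 1) x ∂P) :=
      L.integral_comp_comm (hint (n + 1)).integrableOn
    have h2 : ∫ x in cyl γ n, G n x ∂P = ∫ x in cyl γ n, G n γ ∂P :=
      setIntegral_congr_fun MeasurableSpace.measurableSet_top fun γ' hγ' ↦
        hGdet n γ' γ (hmem_cyl hγ')
    rw [h1, hGcyl, h2, setIntegral_const, map_smul, smul_eq_mul, ← measureReal_def,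
      mul_div_cancel_left₀]
    rw [measureReal_def, ENNReal.toReal_ne_zero]
    exact ⟨hγ0, measure_ne_top _ _⟩
  have hcond : ∀ n, G n =ᵐ[P] P[G (n + 1) | 𝒢 n] := by
    intro n
    have h1 := Complex.reCLM.comp_condExp_comm (μ := P) (m := 𝒢 n) (hint (n + 1))
    have h2 := Complex.imCLM.comp_condExp_comm (μ := P) (m := 𝒢 n) (hint (n + 1))
    filter_upwards [h1, h2, hreal Complex.reCLM n, hreal Complex.imCLM n] with γ e1 e2 e3 e4
    apply Complex.ext
    · rw [show (P[G (n + 1) | 𝒢 n] γ).re = (Complex.reCLM ∘ P[G (n + 1) | 𝒢 n]) γ from rfl, e1]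
      exact e3.symm
    · rw [show (P[G (n + 1) | 𝒢 n] γ).im = (Complex.imCLM ∘ P[G (n + 1) | 𝒢 n]) γ from rfl, e2]
      exact e4.symm
  have hmart : Martingale G 𝒢 P := martingale_nat hGad hint hcond
  have hGval : ∀ (n : ℕ) (γ : SAW.DomainSAW D.carrier δ a b), ∃ k : ℕ,
      G n γ = Q γ k ∧ f γ k ≤ T := by
    intro n γ
    refine ⟨min n (fb γ), rfl, ?_⟩
    have ht0 : (0 : ℝ) ≤ t₁ := t₁.coe_nonneg
    rcases lt_or_ge n (fb γ) with hn | hn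
    · rw [min_eq_left hn.le]
      have := (hgood_of_lt hn).2.2.1
      change f γ n ≤ t₁ + θ at this
      linarith
    · rw [min_eq_right hn]
      rcases h0 : fb γ with _ | j
      · have := hstem γ
        change f γ 0 ≤ θ at this
        linarith
      · have hgood := hgood_of_lt (show j < fb γ by omega)
        have h1 : f γ j ≤ t₁ + θ := hgood.2.2.1
        have h2 := hstep γ j θ hθ hgood.2.2.2
        linarith
  refine ⟨𝒢, σ, τ, hσ, M, G, hτ, hmart, hστ, hτM, fun u hu ↦ ?_, hGval, fun γ hγ ↦ ?_⟩
  · /- the driver values at times `≤ s₁` are `𝒢_σ`-measurable -/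
    refine hσmeas _ fun k γ γ' hk hkM h ↦ ?_
    obtain ⟨i, hik, hci⟩ := exists_partialSups_eq (f γ) k
    have hsi : (s₁ : ℝ) ≤ f γ i := hci ▸ hσlt γ k hk hkM
    exact hcons γ γ' i (hnest hik h) ((NNReal.coe_le_coe.2 hS).trans hsi) u
      ((NNReal.coe_le_coe.2 hu).trans hsi)
  · /- off the strong capacity event: the first passages and the dichotomy -/
    simp only [mem_setOf_eq, not_or, not_forall, not_le, not_exists, not_and, not_lt] at hγ
    obtain ⟨⟨k₀, hk₀⟩, hincr⟩ := hγ
    have hTM : T < partialSups (f γ) M := hk₀.trans_le (hfM γ k₀)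
    have ht₁T : (t₁ : ℝ) ≤ T := by linarith
    -- first passages of the running maximum: the clock itself sits in `[L, L + θ]`
    have hpass : ∀ (L : ℝ) (ϑ : SAW.DomainSAW D.carrier δ a b → WithTop ℕ), 0 ≤ L → L ≤ T →
        (∃ k : ℕ, ϑ γ = k ∧ k ≤ M ∧ (L ≤ partialSups (f γ) M →
          L ≤ partialSups (f γ) k ∧ ∀ j < k, partialSups (f γ) j < L)) →
        ∃ k : ℕ, ϑ γ = k ∧ L ≤ f γ k ∧ f γ k ≤ L + θ ∧ (∀ i < k, f γ i < L) ∧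
          k ≤ γ.walk.length := by
      rintro L ϑ hL hLT ⟨k, hϑk, -, hspec⟩
      obtain ⟨hLk, hbefore⟩ := hspec (hLT.trans hTM.le)
      have hbf : ∀ i < k, f γ i < L := fun i hi ↦ (le_partialSups (f γ) i).trans_lt (hbefore i hi)
      obtain ⟨j, hjk, hcj⟩ := exists_partialSups_eq (f γ) k
      have hjk' : j = k := by
        by_contra hne
        have h1 := hbefore j (lt_of_le_of_ne hjk hne)
        have h2 : f γ j ≤ partialSups (f γ) j := le_partialSups (f γ) j
        linarith
      subst hjk'
      refine ⟨j, hϑk, hcj ▸ hLk, ?_, hbf, ?_⟩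
      · rcases j with _ | i
        · have := hstem γ
          change f γ 0 ≤ θ at this
          linarith
        · have hi : f γ i < L := hbf i (Nat.lt_succ_self i)
          have := hstep γ i θ hθ fun u ↦ hincr i u (by linarith)
          linarith
      · by_contra hlt
        have hlt' : γ.walk.length < j := not_le.1 hlt
        have h1 := hbf _ hlt'
        have h2 : f γ j ≤ f γ γ.walk.length := (hflen γ hlt'.le).le
        linarith [hcj ▸ hLk]
    obtain ⟨j, hσj, hsj, hjs, -, -⟩ :=
      hpass s₁ σ s₁.coe_nonneg ((NNReal.coe_le_coe.2 hst).trans ht₁T) (hσspec γ)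
    obtain ⟨k, hτk, htk, hkt, hbk, hklen⟩ := hpass t₁ τ t₁.coe_nonneg ht₁T (hτspec γ)
    have hjk : j ≤ k := by
      have := hστ γ
      rw [hσj, hτk] at this
      exact WithTop.coe_le_coe.1 this
    have hkM : k ≤ M := by
      have := hτM γ
      rw [hτk] at this
      exact WithTop.coe_le_coe.1 this
    refine ⟨j, k, hσj, hτk, hsj, hjs, htk, hkt, ?_⟩
    have hsvσ : stoppedValue G σ γ = G j γ := by simp only [stoppedValue, hσj]; rfl
    have hsvτ : stoppedValue G τ γ = G k γ := by simp only [stoppedValue, hτk]; rfl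
    by_cases hall : ∀ i < k, Good i γ
    · -- all pasts before `k` are good: not yet frozen
      left
      have hfk : k ≤ fb γ := by
        rw [hfb, Nat.le_find_iff]
        exact fun i hi ↦ not_or.2 ⟨not_not.2 (hall i hi), by omega⟩
      rw [hsvσ, hsvτ]
      simp only [hG, min_eq_left (hjk.trans hfk), min_eq_left hfk]
      exact ⟨rfl, rfl⟩
    · -- a bad past before `k`: `z` on it or a dead step, so `Q_k = 0`
      right
      push Not at hall
      obtain ⟨i, hik, hbad⟩ := hall
      have hfi : f γ i < t₁ := hbk i hik
      have hC : LatticeSlit.capTime φ (prefixAt γ i) ≤ t₁ + θ := by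
        change f γ i ≤ t₁ + θ; linarith
      have hD : ∀ u : Site 2, LatticeSlit.capIncrement φ (prefixAt γ i) u ≤ θ :=
        fun u ↦ hincr i u (by linarith)
      refine paraDoob_eq_zero_of_bad γ hik (by omega) ?_
      by_contra hcon
      simp only [not_or, not_exists, not_and] at hcon
      exact hbad ⟨hcon.1, fun x u h1 h2 h3 h4 ↦ not_forall_not.1 (hcon.2 x u h1 h2 h3 h4), hC, hD⟩

end Summit.CriticalPhenomena.SAWScalingLimit.Theorems.SubseqIdentification.ParaMartingale

end
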